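import Summits.AtomisticToContinuum.Crystallization.Theorems.ChartedPlanarOrderPatternLayerTables

/-!
# First-shell pairs of the two-shell patterns: antipodal separation, angles, height classes (decomp-a2c lens-3 g23 → g24-2 (α))

Real-level consequences of the integer tables (`…PatternLayerTables` and §1 below) for the two-shell patterns
`P ∈ {fccTwoShellPattern, hcpTwoShellPattern}` of `Literature.Geometry.DiscreteGeometry`, as consumed by the layering dichotomy
«StackedDichotomy» (critic row 445 (iii)): for two FIRST-SHELL pattern vectors `x ≠ ±y` whose antipodes `−x, −y` also belong to the pattern
(the situation of the two in-plane periods `±a, ±b` of a clean layered set, matched in every environment),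
* §2–3 `third_le_norm_add_sq_of_mem_twoShellPattern` / `add_eq_zero_of_norm_add_lt_half`: `x + y ≠ 0 → 1/3 ≤ ‖x + y‖²` (antipodal separation —
  sharp for hcp, where an upper first-shell vector and a mirrored second-shell vector sum to norm `1/√3`; a matched antipode within `1/2` IS the antipode);
* §3 `inner_first_shell_pair`: `⟪x, y⟫ ∈ {1/2, −1/2}` (TRIANGULAR pair) or `⟪x, y⟫ = 0 ∧ P = fcc` (SQUARE pair — never in hcp);
* §4 `exists_normal_height_classes`: a unit normal `n ⊥ x, y` such that every pattern vector has height `⟪n, z⟫ ∈ {0, ±h, ±2h}`, first-shell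
  vectors `∈ {0, ±h}`, with `h = √6/3` (triangular) resp. `h = √2/2` (square), and both an «up-site» and a «down-site» of the first shell exist.
No `sorry`, no new axioms, no `instance` / `notation`; integer facts by `decide`, the rest is `√`-arithmetic.
-/

namespace Summit.AtomisticToContinuum.Crystallization.Theorems.ChartedPlanarOrderPatternPairGeometry

open Literature.Geometry.DiscreteGeometry ChartedPlanarOrderPatternLayerTables
open scoped RealInnerProductSpace

/-! ## 1. Integer tables (kernel-decided), stated over the FULL two-shell tables with squared-norm hypotheses -/

/-- fcc: non-antipodal table vectors have `|v + w|² ≥ 2`. [folklore] -/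
theorem fcc_add_sqNorm : ∀ v ∈ fccInt ∪ fccSecondShellInt, ∀ w ∈ fccInt ∪ fccSecondShellInt, v + w ≠ 0 →
    (2 : ℤ) ≤ sqNormInt (v + w) := by decide

/-- hcp: non-antipodal table vectors have `|v + w|² ≥ 6` (sharp: an upper first-shell vector and a mirrored second-shell vector, e.g.
`(3,3,0) + (−4,−4,2) = (−1,−1,2)` — the hcp two-shell pattern is NOT antipodally separated at scale `1`, only at scale `1/√3`). [folklore] -/
theorem hcp_add_sqNorm : ∀ v ∈ hcpInt ∪ hcpSecondShellInt, ∀ w ∈ hcpInt ∪ hcpSecondShellInt, v + w ≠ 0 →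
    (6 : ℤ) ≤ sqNormInt (v + w) := by decide

/-- hcp, first shell only: the same bound `6` is attained by an upper–lower pair (dot `−15`: `36 − 30 = 6`, cosine `−5/6`). [folklore] -/
theorem hcpInt_add_sqNorm : ∀ v ∈ hcpInt, ∀ w ∈ hcpInt, v + w ≠ 0 → (6 : ℤ) ≤ sqNormInt (v + w) := by decide

/-- fcc: two distinct non-antipodal first-shell vectors have dot `∈ {1, 0, −1}`. [folklore] -/
theorem fcc_pair_dot : ∀ v ∈ fccInt ∪ fccSecondShellInt, ∀ w ∈ fccInt ∪ fccSecondShellInt, sqNormInt v = 2 → sqNormInt w = 2 →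
    v ≠ w → v + w ≠ 0 → dotInt v w = 1 ∨ dotInt v w = 0 ∨ dotInt v w = -1 := by decide

/-- hcp: two distinct non-antipodal first-shell vectors WHOSE ANTIPODES ARE TABLE VECTORS (hence basal) have dot `∈ {9, −9}`. [folklore] -/
theorem hcp_pair_dot : ∀ v ∈ hcpInt ∪ hcpSecondShellInt, ∀ w ∈ hcpInt ∪ hcpSecondShellInt, sqNormInt v = 18 → sqNormInt w = 18 →
    -v ∈ hcpInt ∪ hcpSecondShellInt → -w ∈ hcpInt ∪ hcpSecondShellInt → v ≠ w → v + w ≠ 0 → dotInt v w = 9 ∨ dotInt v w = -9 := by decide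

/-- fcc heights over a first-shell pair: `u · (v × w) ∈ {0, ±2, ±4}`, first-shell `u` and triangular pairs only `{0, ±2}`; `|v × w|² = 3`
(triangular) or `4` (square); up- and down-sites exist. [folklore] -/
theorem fcc_pair_heights : ∀ v ∈ fccInt ∪ fccSecondShellInt, ∀ w ∈ fccInt ∪ fccSecondShellInt, sqNormInt v = 2 → sqNormInt w = 2 →
    v ≠ w → v + w ≠ 0 →
    (∀ u ∈ fccInt ∪ fccSecondShellInt, dotInt u (crossInt v w) = 0 ∨ dotInt u (crossInt v w) = 2 ∨ dotInt u (crossInt v w) = -2 ∨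
      dotInt u (crossInt v w) = 4 ∨ dotInt u (crossInt v w) = -4) ∧
    (∀ u ∈ fccInt ∪ fccSecondShellInt, (sqNormInt u = 2 ∨ dotInt v w ≠ 0) →
      dotInt u (crossInt v w) = 0 ∨ dotInt u (crossInt v w) = 2 ∨ dotInt u (crossInt v w) = -2) ∧
    (dotInt v w ≠ 0 → sqNormInt (crossInt v w) = 3) ∧ (dotInt v w = 0 → sqNormInt (crossInt v w) = 4) ∧
    (∃ u ∈ fccInt ∪ fccSecondShellInt, sqNormInt u = 2 ∧ dotInt u (crossInt v w) = 2) ∧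
    (∃ u ∈ fccInt ∪ fccSecondShellInt, sqNormInt u = 2 ∧ dotInt u (crossInt v w) = -2) := by decide

/-- hcp heights over a basal first-shell pair: `u · (v × w) ∈ {0, ±54}`, `|v × w|² = 243`; up- and down-sites exist. [folklore] -/
theorem hcp_pair_heights : ∀ v ∈ hcpInt ∪ hcpSecondShellInt, ∀ w ∈ hcpInt ∪ hcpSecondShellInt, sqNormInt v = 18 → sqNormInt w = 18 →
    -v ∈ hcpInt ∪ hcpSecondShellInt → -w ∈ hcpInt ∪ hcpSecondShellInt → v ≠ w → v + w ≠ 0 →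
    (∀ u ∈ hcpInt ∪ hcpSecondShellInt, dotInt u (crossInt v w) = 0 ∨ dotInt u (crossInt v w) = 54 ∨ dotInt u (crossInt v w) = -54) ∧
    sqNormInt (crossInt v w) = 243 ∧
    (∃ u ∈ hcpInt ∪ hcpSecondShellInt, sqNormInt u = 18 ∧ dotInt u (crossInt v w) = 54) ∧
    (∃ u ∈ hcpInt ∪ hcpSecondShellInt, sqNormInt u = 18 ∧ dotInt u (crossInt v w) = -54) := by decide

/-- `v · (v × w) = 0`. [folklore] -/
theorem dotInt_crossInt_left (v w : Fin 3 → ℤ) : dotInt v (crossInt v w) = 0 := by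
  simp [dotInt, crossInt]; ring

/-- `w · (v × w) = 0`. [folklore] -/
theorem dotInt_crossInt_right (v w : Fin 3 → ℤ) : dotInt w (crossInt v w) = 0 := by
  simp [dotInt, crossInt]; ring

/-! ## 2. Generic real-level lemmas for a scaled pattern `{v/√N : v ∈ T}` -/

section Scaled

variable {T : Finset (Fin 3 → ℤ)} {N : ℕ}

/-- inner products in a scaled pattern: `⟪v/√N, w/√N⟫ = (v · w)/N`. -/
theorem inner_scaled (hN : N ≠ 0) (v w : Fin 3 → ℤ) :
    ⟪((Real.sqrt N)⁻¹ • intVec v : EuclideanSpace ℝ (Fin 3)), (Real.sqrt N)⁻¹ • intVec w⟫ = (dotInt v w : ℝ) / N := by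
  have hNpos : (0 : ℝ) < N := by exact_mod_cast Nat.pos_of_ne_zero hN
  rw [real_inner_smul_left, real_inner_smul_right, inner_intVec, ← mul_assoc, ← mul_inv,
    Real.mul_self_sqrt hNpos.le, inv_mul_eq_div]

/-- membership of the antipode transfers to the integer table. -/
theorem neg_mem_table (hN : N ≠ 0) {v : Fin 3 → ℤ}
    (h : -((Real.sqrt N)⁻¹ • intVec v : EuclideanSpace ℝ (Fin 3)) ∈ scaledPattern T N) : -v ∈ T := by
  obtain ⟨v', hv', h'⟩ := Finset.mem_image.1 h
  have hneg : intVec (-v) = -intVec v := by ext i; simp [intVec]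
  have : v' = -v := scaledPattern_map_injective hN (by simp only [h', hneg, smul_neg])
  exact this ▸ hv'

/-- a unit vector of a scaled pattern whose table vectors have squared norm `N` or `2N` has squared norm `N`. -/
theorem sqNorm_eq_of_norm_eq_one (hN : N ≠ 0) (hT : ∀ v ∈ T, sqNormInt v = N ∨ sqNormInt v = 2 * N) {v : Fin 3 → ℤ} (hv : v ∈ T)
    (h1 : ‖((Real.sqrt N)⁻¹ • intVec v : EuclideanSpace ℝ (Fin 3))‖ = 1) : sqNormInt v = N := by
  rcases hT v hv with h | h
  · exact h
  · exfalso
    have hNpos : (0 : ℝ) < N := by exact_mod_cast Nat.pos_of_ne_zero hN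
    have hsq : ‖((Real.sqrt N)⁻¹ • intVec v : EuclideanSpace ℝ (Fin 3))‖ ^ 2 = 2 := by
      rw [← real_inner_self_eq_norm_sq, inner_scaled hN]
      have : (dotInt v v : ℝ) = 2 * N := by
        have : dotInt v v = sqNormInt v := by simp [dotInt, sqNormInt]; ring
        rw [this, h]; push_cast; ring
      rw [this]; field_simp
    rw [h1] at hsq; norm_num at hsq

/-- antipodal separation in a scaled pattern: `‖x + y‖² ≥ M/N` when non-antipodal table sums have squared norm `≥ M`. -/
theorem le_norm_add_sq_of_mem_scaledPattern (hN : N ≠ 0) {M : ℤ} (hT : ∀ v ∈ T, ∀ w ∈ T, v + w ≠ 0 → M ≤ sqNormInt (v + w))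
    {x y : EuclideanSpace ℝ (Fin 3)} (hx : x ∈ scaledPattern T N) (hy : y ∈ scaledPattern T N) (hxy : x + y ≠ 0) :
    (M : ℝ) / N ≤ ‖x + y‖ ^ 2 := by
  obtain ⟨v, hv, rfl⟩ := Finset.mem_image.1 hx
  obtain ⟨w, hw, rfl⟩ := Finset.mem_image.1 hy
  have hvw : v + w ≠ 0 := by
    intro h; apply hxy
    rw [← smul_add, ← intVec_add, h, smul_eq_zero]; right; ext i; simp [intVec]
  have hNpos : (0 : ℝ) < N := by exact_mod_cast Nat.pos_of_ne_zero hN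
  have hsq : ‖((Real.sqrt N)⁻¹ • intVec v + (Real.sqrt N)⁻¹ • intVec w : EuclideanSpace ℝ (Fin 3))‖ ^ 2 = (sqNormInt (v + w) : ℝ) / N := by
    rw [← smul_add, ← intVec_add, ← real_inner_self_eq_norm_sq, inner_scaled hN]
    congr 1; simp [dotInt, sqNormInt]; ring
  rw [hsq]; exact div_le_div_of_nonneg_right (by exact_mod_cast hT v hv w hw hvw) hNpos.le

end Scaled

/-! ## 3. Angles of an antipodally closed first-shell pair -/

/-- **Antipodal separation** in either two-shell pattern: `x + y ≠ 0 → 1/3 ≤ ‖x + y‖²` (fcc: `≥ 1`; hcp: `= 1/3` is attained by an upper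
first-shell vector and a mirrored second-shell vector — so a MATCHED antipode within `1/2` is the exact antipode). -/
theorem third_le_norm_add_sq_of_mem_twoShellPattern {P : Finset (EuclideanSpace ℝ (Fin 3))} (hP : P = fccTwoShellPattern ∨ P = hcpTwoShellPattern)
    {x y : EuclideanSpace ℝ (Fin 3)} (hx : x ∈ P) (hy : y ∈ P) (hxy : x + y ≠ 0) : 1 / 3 ≤ ‖x + y‖ ^ 2 := by
  rcases hP with rfl | rfl
  · have h := le_norm_add_sq_of_mem_scaledPattern two_ne_zero fcc_add_sqNorm hx hy hxy
    push_cast at h; linarith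
  · have h := le_norm_add_sq_of_mem_scaledPattern (by norm_num) hcp_add_sqNorm hx hy hxy
    push_cast at h; linarith

/-- the usable form: two pattern vectors with `‖x + y‖ < 1/2` ARE antipodal. -/
theorem add_eq_zero_of_norm_add_lt_half {P : Finset (EuclideanSpace ℝ (Fin 3))} (hP : P = fccTwoShellPattern ∨ P = hcpTwoShellPattern)
    {x y : EuclideanSpace ℝ (Fin 3)} (hx : x ∈ P) (hy : y ∈ P) (h : ‖x + y‖ < 1 / 2) : x + y = 0 := by
  by_contra hxy
  have h3 := third_le_norm_add_sq_of_mem_twoShellPattern hP hx hy hxy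
  nlinarith [norm_nonneg (x + y)]

/-- squared norms of the fcc table as `N ∨ 2N`. -/
theorem fcc_sqNorm_cases : ∀ v ∈ fccInt ∪ fccSecondShellInt, sqNormInt v = (2 : ℕ) ∨ sqNormInt v = 2 * (2 : ℕ) := by decide

/-- squared norms of the hcp table as `N ∨ 2N`. -/
theorem hcp_sqNorm_cases : ∀ v ∈ hcpInt ∪ hcpSecondShellInt, sqNormInt v = (18 : ℕ) ∨ sqNormInt v = 2 * (18 : ℕ) := by decide

/-- **Pair angles.** Two distinct, non-antipodal FIRST-SHELL vectors of a two-shell pattern whose antipodes belong to the pattern make an angle of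
`60°` or `120°` (TRIANGULAR pair, either pattern) or `90°` (SQUARE pair, fcc only). -/
theorem inner_first_shell_pair {P : Finset (EuclideanSpace ℝ (Fin 3))} (hP : P = fccTwoShellPattern ∨ P = hcpTwoShellPattern)
    {x y : EuclideanSpace ℝ (Fin 3)} (hx : x ∈ P) (hy : y ∈ P) (hx1 : ‖x‖ = 1) (hy1 : ‖y‖ = 1) (hnx : -x ∈ P) (hny : -y ∈ P)
    (hxy : x ≠ y) (hxy' : x + y ≠ 0) : (⟪x, y⟫ = 1 / 2 ∨ ⟪x, y⟫ = -1 / 2) ∨ (⟪x, y⟫ = 0 ∧ P = fccTwoShellPattern) := by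
  rcases hP with rfl | rfl
  · obtain ⟨v, hv, rfl⟩ := Finset.mem_image.1 hx
    obtain ⟨w, hw, rfl⟩ := Finset.mem_image.1 hy
    have hv2 := sqNorm_eq_of_norm_eq_one two_ne_zero fcc_sqNorm_cases hv hx1
    have hw2 := sqNorm_eq_of_norm_eq_one two_ne_zero fcc_sqNorm_cases hw hy1
    have hne : v ≠ w := fun h => hxy (by rw [h])
    have hne' : v + w ≠ 0 := by
      intro h; apply hxy'; rw [← smul_add, ← intVec_add, h, smul_eq_zero]; right; ext i; simp [intVec]
    have key := fcc_pair_dot v hv w hw hv2 hw2 hne hne'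
    rw [inner_scaled two_ne_zero]
    rcases key with h | h | h <;> rw [h] <;> norm_num
  · obtain ⟨v, hv, rfl⟩ := Finset.mem_image.1 hx
    obtain ⟨w, hw, rfl⟩ := Finset.mem_image.1 hy
    have h18 : (18 : ℕ) ≠ 0 := by norm_num
    have hv2 := sqNorm_eq_of_norm_eq_one h18 hcp_sqNorm_cases hv hx1
    have hw2 := sqNorm_eq_of_norm_eq_one h18 hcp_sqNorm_cases hw hy1
    have hne : v ≠ w := fun h => hxy (by rw [h])
    have hne' : v + w ≠ 0 := by
      intro h; apply hxy'; rw [← smul_add, ← intVec_add, h, smul_eq_zero]; right; ext i; simp [intVec]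
    have key := hcp_pair_dot v hv w hw hv2 hw2 (neg_mem_table h18 hnx) (neg_mem_table h18 hny) hne hne'
    left; rw [inner_scaled h18]
    rcases key with h | h <;> rw [h] <;> norm_num

/-! ## 4. The unit normal of a first-shell pair and the height classes of the pattern -/

/-- `dotInt` is symmetric. -/
theorem dotInt_comm (s t : Fin 3 → ℤ) : dotInt s t = dotInt t s := by
  simp [dotInt]; ring

/-- the unit normal `(v × w)/|v × w|` of an integer pair, as a real vector. -/
noncomputable def unitNormal (v w : Fin 3 → ℤ) : EuclideanSpace ℝ (Fin 3) :=
  (Real.sqrt (sqNormInt (crossInt v w)))⁻¹ • intVec (crossInt v w)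

/-- `‖(v × w)/|v × w|‖ = 1` when `v × w ≠ 0`. -/
theorem norm_unitNormal {v w : Fin 3 → ℤ} (h : sqNormInt (crossInt v w) ≠ 0) : ‖unitNormal v w‖ = 1 := by
  have hpos : (0 : ℝ) < (sqNormInt (crossInt v w) : ℝ) := by
    have : 0 ≤ sqNormInt (crossInt v w) := by unfold sqNormInt; positivity
    exact_mod_cast lt_of_le_of_ne this (Ne.symm h)
  have hs : 0 < Real.sqrt (sqNormInt (crossInt v w)) := Real.sqrt_pos.mpr hpos
  rw [unitNormal, norm_smul, norm_inv, Real.norm_of_nonneg hs.le, norm_intVec, inv_mul_cancel₀ hs.ne']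

/-- heights of scaled table vectors over the pair: `⟪(v × w)/|v × w|, u/√N⟫ = (u · (v × w)) / (|v × w| √N)`. -/
theorem inner_unitNormal_scaled (N : ℕ) (v w u : Fin 3 → ℤ) :
    ⟪unitNormal v w, ((Real.sqrt N)⁻¹ • intVec u : EuclideanSpace ℝ (Fin 3))⟫ =
      (dotInt u (crossInt v w) : ℝ) / (Real.sqrt (sqNormInt (crossInt v w)) * Real.sqrt N) := by
  rw [unitNormal, real_inner_smul_left, real_inner_smul_right, inner_intVec, dotInt_comm, div_eq_mul_inv, mul_inv]
  ring

/-- the normal is orthogonal to the first vector of the pair. -/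
theorem inner_unitNormal_fst (N : ℕ) (v w : Fin 3 → ℤ) : ⟪unitNormal v w, ((Real.sqrt N)⁻¹ • intVec v : EuclideanSpace ℝ (Fin 3))⟫ = 0 := by
  rw [inner_unitNormal_scaled, dotInt_crossInt_left]; simp

/-- the normal is orthogonal to the second vector of the pair. -/
theorem inner_unitNormal_snd (N : ℕ) (v w : Fin 3 → ℤ) : ⟪unitNormal v w, ((Real.sqrt N)⁻¹ • intVec w : EuclideanSpace ℝ (Fin 3))⟫ = 0 := by
  rw [inner_unitNormal_scaled, dotInt_crossInt_right]; simp

/-- `2/(√3·√2) = √6/3` (triangular fcc layer spacing in contact units: `√(2/3)`). -/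
theorem two_div_sqrt_three_mul_sqrt_two : (2 : ℝ) / (Real.sqrt 3 * Real.sqrt 2) = Real.sqrt 6 / 3 := by
  have h6 : Real.sqrt 3 * Real.sqrt 2 = Real.sqrt 6 := by rw [← Real.sqrt_mul (by norm_num)]; norm_num
  have hs : 0 < Real.sqrt 6 := Real.sqrt_pos.mpr (by norm_num)
  rw [h6, div_eq_div_iff hs.ne' (by norm_num)]
  nlinarith [Real.mul_self_sqrt (show (0 : ℝ) ≤ 6 by norm_num)]

/-- `54/(√243·√18) = √6/3` (triangular hcp layer spacing: the same `√(2/3)`). -/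
theorem div_sqrt_243_mul_sqrt_18 : (54 : ℝ) / (Real.sqrt 243 * Real.sqrt 18) = Real.sqrt 6 / 3 := by
  have h : Real.sqrt 243 * Real.sqrt 18 = 27 * Real.sqrt 6 := by
    rw [← Real.sqrt_mul (by norm_num), show (243 : ℝ) * 18 = 27 ^ 2 * 6 by norm_num, Real.sqrt_mul (by norm_num),
      Real.sqrt_sq (by norm_num)]
  have hs : 0 < Real.sqrt 6 := Real.sqrt_pos.mpr (by norm_num)
  rw [h, div_eq_div_iff (by positivity) (by norm_num)]
  nlinarith [Real.mul_self_sqrt (show (0 : ℝ) ≤ 6 by norm_num)]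

/-- `2/(√4·√2) = √2/2` (square fcc layer spacing in contact units: `1/√2`). -/
theorem two_div_sqrt_four_mul_sqrt_two : (2 : ℝ) / (Real.sqrt 4 * Real.sqrt 2) = Real.sqrt 2 / 2 := by
  have hs : 0 < Real.sqrt 2 := Real.sqrt_pos.mpr (by norm_num)
  rw [show Real.sqrt 4 = 2 by rw [show (4 : ℝ) = 2 ^ 2 by norm_num, Real.sqrt_sq (by norm_num)],
    div_eq_div_iff (by positivity) (by norm_num)]
  nlinarith [Real.mul_self_sqrt (show (0 : ℝ) ≤ 2 by norm_num)]

/-- **Height classes over an antipodally closed first-shell pair.** For `x ≠ ±y` first-shell vectors of a two-shell pattern `P` whose antipodes lie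
in `P` there is a unit normal `n ⊥ x, y` and a spacing `h` — `h = √6/3 = √(2/3)` for a TRIANGULAR pair (`⟪x,y⟫ = ±1/2`), `h = √2/2 = 1/√2` for a
SQUARE pair (`⟪x,y⟫ = 0`, fcc only) — such that every pattern vector has height `⟪n, z⟫ ∈ {0, ±h, ±2h}`, every first-shell vector (and, for a
triangular pair, every pattern vector) has height `∈ {0, ±h}`, and first-shell vectors of heights `+h` («up-site») and `−h` («down-site») exist. -/
theorem exists_normal_height_classes {P : Finset (EuclideanSpace ℝ (Fin 3))} (hP : P = fccTwoShellPattern ∨ P = hcpTwoShellPattern)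
    {x y : EuclideanSpace ℝ (Fin 3)} (hx : x ∈ P) (hy : y ∈ P) (hx1 : ‖x‖ = 1) (hy1 : ‖y‖ = 1) (hnx : -x ∈ P) (hny : -y ∈ P)
    (hxy : x ≠ y) (hxy' : x + y ≠ 0) :
    ∃ n : EuclideanSpace ℝ (Fin 3), ‖n‖ = 1 ∧ ⟪n, x⟫ = 0 ∧ ⟪n, y⟫ = 0 ∧ ∃ h : ℝ,
      ((h = Real.sqrt 6 / 3 ∧ (⟪x, y⟫ = 1 / 2 ∨ ⟪x, y⟫ = -1 / 2)) ∨ (h = Real.sqrt 2 / 2 ∧ ⟪x, y⟫ = 0 ∧ P = fccTwoShellPattern)) ∧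
      (∀ z ∈ P, ⟪n, z⟫ = 0 ∨ ⟪n, z⟫ = h ∨ ⟪n, z⟫ = -h ∨ ⟪n, z⟫ = 2 * h ∨ ⟪n, z⟫ = -(2 * h)) ∧
      (∀ z ∈ P, (‖z‖ = 1 ∨ h = Real.sqrt 6 / 3) → ⟪n, z⟫ = 0 ∨ ⟪n, z⟫ = h ∨ ⟪n, z⟫ = -h) ∧
      (∃ z ∈ P, ‖z‖ = 1 ∧ ⟪n, z⟫ = h) ∧ (∃ z ∈ P, ‖z‖ = 1 ∧ ⟪n, z⟫ = -h) := by
  -- (gate-forced dedup delta: the unit-norm helper is a local `have`; tree twin `norm_scaled_intVec`)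
  have norm_scaled_eq_one : ∀ {N : ℕ}, N ≠ 0 → ∀ {u : Fin 3 → ℤ}, sqNormInt u = N →
      ‖((Real.sqrt N)⁻¹ • intVec u : EuclideanSpace ℝ (Fin 3))‖ = 1 := by
    intro N hN u hu
    have hpos : (0 : ℝ) < Real.sqrt N := by positivity
    rw [norm_smul, norm_inv, Real.norm_of_nonneg hpos.le, norm_intVec, hu, Int.cast_natCast, inv_mul_cancel₀ hpos.ne']
  rcases hP with rfl | rfl
  · -- fcc
    obtain ⟨v, hv, rfl⟩ := Finset.mem_image.1 hx
    obtain ⟨w, hw, rfl⟩ := Finset.mem_image.1 hy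
    have hv2 := sqNorm_eq_of_norm_eq_one two_ne_zero fcc_sqNorm_cases hv hx1
    have hw2 := sqNorm_eq_of_norm_eq_one two_ne_zero fcc_sqNorm_cases hw hy1
    have hne : v ≠ w := fun h => hxy (by rw [h])
    have hne' : v + w ≠ 0 := by
      intro h; apply hxy'; rw [← smul_add, ← intVec_add, h, smul_eq_zero]; right; ext i; simp [intVec]
    obtain ⟨hall, hfirst, hD3, hD4, ⟨uU, huU, huU2, huUt⟩, ⟨uD, huD, huD2, huDt⟩⟩ := fcc_pair_heights v hv w hw hv2 hw2 hne hne'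
    have hdot := fcc_pair_dot v hv w hw hv2 hw2 hne hne'
    have hxyval : ⟪((Real.sqrt (2 : ℕ))⁻¹ • intVec v : EuclideanSpace ℝ (Fin 3)), (Real.sqrt (2 : ℕ))⁻¹ • intVec w⟫ = (dotInt v w : ℝ) / 2 := by
      rw [inner_scaled two_ne_zero]; norm_num
    by_cases hd0 : dotInt v w = 0
    · -- SQUARE pair
      have hD : sqNormInt (crossInt v w) = 4 := hD4 hd0
      have hD0 : sqNormInt (crossInt v w) ≠ 0 := by rw [hD]; norm_num
      refine ⟨unitNormal v w, norm_unitNormal hD0, inner_unitNormal_fst _ _ _, inner_unitNormal_snd _ _ _, Real.sqrt 2 / 2,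
        Or.inr ⟨rfl, by rw [hxyval, hd0]; norm_num, rfl⟩, ?_, ?_, ?_, ?_⟩
      · intro z hz
        obtain ⟨u, hu, rfl⟩ := Finset.mem_image.1 hz
        rw [inner_unitNormal_scaled, hD]; push_cast
        rw [← two_div_sqrt_four_mul_sqrt_two]
        rcases hall u hu with h | h | h | h | h <;> rw [h] <;> norm_num [div_eq_mul_inv] <;> ring_nf <;> norm_num
      · intro z hz hz1
        obtain ⟨u, hu, rfl⟩ := Finset.mem_image.1 hz
        have hu2 : sqNormInt u = 2 := by
          rcases hz1 with h1 | h1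
          · exact_mod_cast sqNorm_eq_of_norm_eq_one two_ne_zero fcc_sqNorm_cases hu h1
          · exfalso
            have h := congrArg (fun r : ℝ => r ^ 2) h1
            simp only [div_pow, Real.sq_sqrt (show (0:ℝ) ≤ 2 by norm_num), Real.sq_sqrt (show (0:ℝ) ≤ 6 by norm_num)] at h
            norm_num at h
        rw [inner_unitNormal_scaled, hD]; push_cast
        rw [← two_div_sqrt_four_mul_sqrt_two]
        rcases hfirst u hu (Or.inl hu2) with h | h | h <;> rw [h] <;> norm_num [div_eq_mul_inv]
      · refine ⟨_, Finset.mem_image_of_mem _ huU, norm_scaled_eq_one two_ne_zero (by exact_mod_cast huU2), ?_⟩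
        rw [inner_unitNormal_scaled, hD, huUt]; push_cast; exact two_div_sqrt_four_mul_sqrt_two
      · refine ⟨_, Finset.mem_image_of_mem _ huD, norm_scaled_eq_one two_ne_zero (by exact_mod_cast huD2), ?_⟩
        rw [inner_unitNormal_scaled, hD, huDt]; push_cast; rw [neg_div, two_div_sqrt_four_mul_sqrt_two]
    · -- TRIANGULAR pair
      have hD : sqNormInt (crossInt v w) = 3 := hD3 hd0
      have hD0 : sqNormInt (crossInt v w) ≠ 0 := by rw [hD]; norm_num
      have hpm : ⟪((Real.sqrt (2 : ℕ))⁻¹ • intVec v : EuclideanSpace ℝ (Fin 3)), (Real.sqrt (2 : ℕ))⁻¹ • intVec w⟫ = 1 / 2 ∨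
          ⟪((Real.sqrt (2 : ℕ))⁻¹ • intVec v : EuclideanSpace ℝ (Fin 3)), (Real.sqrt (2 : ℕ))⁻¹ • intVec w⟫ = -1 / 2 := by
        rw [hxyval]; rcases hdot with h | h | h
        · left; rw [h]; norm_num
        · exact absurd h hd0
        · right; rw [h]; norm_num
      have hcls : ∀ z ∈ scaledPattern (fccInt ∪ fccSecondShellInt) 2, ⟪unitNormal v w, z⟫ = 0 ∨ ⟪unitNormal v w, z⟫ = Real.sqrt 6 / 3 ∨
          ⟪unitNormal v w, z⟫ = -(Real.sqrt 6 / 3) := by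
        intro z hz
        obtain ⟨u, hu, rfl⟩ := Finset.mem_image.1 hz
        rw [inner_unitNormal_scaled, hD]; push_cast
        rw [← two_div_sqrt_three_mul_sqrt_two]
        rcases hfirst u hu (Or.inr hd0) with h | h | h <;> rw [h] <;> norm_num [neg_div]
      refine ⟨unitNormal v w, norm_unitNormal hD0, inner_unitNormal_fst _ _ _, inner_unitNormal_snd _ _ _, Real.sqrt 6 / 3,
        Or.inl ⟨rfl, hpm⟩, ?_, fun z hz _ => hcls z hz, ?_, ?_⟩
      · intro z hz; rcases hcls z hz with h | h | h
        · exact Or.inl h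
        · exact Or.inr (Or.inl h)
        · exact Or.inr (Or.inr (Or.inl h))
      · refine ⟨_, Finset.mem_image_of_mem _ huU, norm_scaled_eq_one two_ne_zero (by exact_mod_cast huU2), ?_⟩
        rw [inner_unitNormal_scaled, hD, huUt]; push_cast; exact two_div_sqrt_three_mul_sqrt_two
      · refine ⟨_, Finset.mem_image_of_mem _ huD, norm_scaled_eq_one two_ne_zero (by exact_mod_cast huD2), ?_⟩
        rw [inner_unitNormal_scaled, hD, huDt]; push_cast; rw [neg_div, two_div_sqrt_three_mul_sqrt_two]
  · -- hcp: always triangular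
    obtain ⟨v, hv, rfl⟩ := Finset.mem_image.1 hx
    obtain ⟨w, hw, rfl⟩ := Finset.mem_image.1 hy
    have h18 : (18 : ℕ) ≠ 0 := by norm_num
    have hv2 := sqNorm_eq_of_norm_eq_one h18 hcp_sqNorm_cases hv hx1
    have hw2 := sqNorm_eq_of_norm_eq_one h18 hcp_sqNorm_cases hw hy1
    have hne : v ≠ w := fun h => hxy (by rw [h])
    have hne' : v + w ≠ 0 := by
      intro h; apply hxy'; rw [← smul_add, ← intVec_add, h, smul_eq_zero]; right; ext i; simp [intVec]
    have hnv := neg_mem_table h18 hnx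
    have hnw := neg_mem_table h18 hny
    obtain ⟨hall, hD, ⟨uU, huU, huU2, huUt⟩, ⟨uD, huD, huD2, huDt⟩⟩ := hcp_pair_heights v hv w hw hv2 hw2 hnv hnw hne hne'
    have hdot := hcp_pair_dot v hv w hw hv2 hw2 hnv hnw hne hne'
    have hD0 : sqNormInt (crossInt v w) ≠ 0 := by rw [hD]; norm_num
    have hpm : ⟪((Real.sqrt (18 : ℕ))⁻¹ • intVec v : EuclideanSpace ℝ (Fin 3)), (Real.sqrt (18 : ℕ))⁻¹ • intVec w⟫ = 1 / 2 ∨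
        ⟪((Real.sqrt (18 : ℕ))⁻¹ • intVec v : EuclideanSpace ℝ (Fin 3)), (Real.sqrt (18 : ℕ))⁻¹ • intVec w⟫ = -1 / 2 := by
      rw [inner_scaled h18]; rcases hdot with h | h
      · left; rw [h]; norm_num
      · right; rw [h]; norm_num
    have hcls : ∀ z ∈ scaledPattern (hcpInt ∪ hcpSecondShellInt) 18, ⟪unitNormal v w, z⟫ = 0 ∨ ⟪unitNormal v w, z⟫ = Real.sqrt 6 / 3 ∨
        ⟪unitNormal v w, z⟫ = -(Real.sqrt 6 / 3) := by
      intro z hz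
      obtain ⟨u, hu, rfl⟩ := Finset.mem_image.1 hz
      rw [inner_unitNormal_scaled, hD]; push_cast
      rw [← div_sqrt_243_mul_sqrt_18]
      rcases hall u hu with h | h | h <;> rw [h] <;> norm_num [neg_div]
    refine ⟨unitNormal v w, norm_unitNormal hD0, inner_unitNormal_fst _ _ _, inner_unitNormal_snd _ _ _, Real.sqrt 6 / 3,
      Or.inl ⟨rfl, hpm⟩, ?_, fun z hz _ => hcls z hz, ?_, ?_⟩
    · intro z hz; rcases hcls z hz with h | h | h
      · exact Or.inl h
      · exact Or.inr (Or.inl h)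
      · exact Or.inr (Or.inr (Or.inl h))
    · refine ⟨_, Finset.mem_image_of_mem _ huU, norm_scaled_eq_one h18 (by exact_mod_cast huU2), ?_⟩
      rw [inner_unitNormal_scaled, hD, huUt]; push_cast; exact div_sqrt_243_mul_sqrt_18
    · refine ⟨_, Finset.mem_image_of_mem _ huD, norm_scaled_eq_one h18 (by exact_mod_cast huD2), ?_⟩
      rw [inner_unitNormal_scaled, hD, huDt]; push_cast; rw [neg_div, div_sqrt_243_mul_sqrt_18]

end Summit.AtomisticToContinuum.Crystallization.Theorems.ChartedPlanarOrderPatternPairGeometry
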